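import Summits.Langlands.Langlands.Theses.FifteenLocusEisenstein

/-!
# Position of `NonOrdinaryEisensteinModular` (stmt-Langlands-16054) inside its route — kernel-checked, sorry-free

Redirect strategist r1 (planner-cstrat-stmt-Langlands-16054-r1-0, 2026-08-17).  Nothing here asserts the crux, the
target or the summit.

* `target_imp_nonOrdinaryEisensteinModular : Target → C` — C is a LITERAL SUB-CASE of the route target (modularity, in
  point-count form, of every non-CM integral Weierstrass model over the integers of an imaginary quadratic field): drop
  the three sector hypotheses `p ≠ 2`, `E[p] reducible`, `no nearly-ordinary irreducible Tate frame`.  (Re-derivation of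
  the crux-attack refuter's `W.lean` (i), whose evidence file is not readable from this hub.)
* `nonOrdinaryEisensteinModular_of_dropped : (∀ F … E …, Δ ≠ 0 → ¬CM → ∀ hcpt, ∃ π …) → C` — same statement, recorded
  with the hypotheses it does NOT need for truth.
* `sectorComplement_of_langlands : Langlands → SectorComplement` — the item that carries the route's RESTATED flag
  (stmt-Langlands-16058) is implied by the summit by discarding its hypothesis; `C` is not: no term of type
  `Langlands → C` exists in this cone (probe files `*_probe_converse.lean`, `*_probe_split.lean`).
* `closes_reading` — the route's deciding theorem read as `Target`-production: the five case cruxes give `Target`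
  (= support item `TargetOfCruxes`, pure logic), and `SectorComplement` is `Target → Langlands` by `Iff.rfl`.
-/

set_option linter.dupNamespace false

namespace Summit.Langlands.Langlands.Cruxes.NonOrdinaryEisensteinModular.RedirectR1

open Summit.Langlands.Langlands.Theses.FifteenLocusEisenstein

/-- `C` is a literal sub-case of the route target. [folklore] -/
theorem target_imp_nonOrdinaryEisensteinModular : Target → NonOrdinaryEisensteinModular := by
  intro hT F _ _ htc hdeg p _ _ E hΔ hcm _ _ hcpt
  exact hT F htc hdeg E hΔ hcm hcpt

/-- The sector hypotheses (`p ≠ 2`, `E[p]` reducible, no nearly-ordinary irreducible Tate frame, and even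
`IsTotallyComplex`/`finrank = 2`) are not needed for TRUTH — only `Δ ≠ 0` and `¬ HasCM` are (refuter's mutation
analysis: `F = ℚ(√-7)`, `p = 7`, `E` CM by `𝓞_F` kills the CM-dropped version). [folklore] -/
theorem nonOrdinaryEisensteinModular_of_dropped
    (h : ∀ (F : Type) [Field F] [NumberField F] (E : WeierstrassCurve (NumberField.RingOfIntegers F)), E.Δ ≠ 0 →
      ¬ (E.baseChange F).HasCM → ∀ (hcpt : Literature.NumberTheory.Automorphic.isCompact_glFiniteIntegralLevel 2 F),
      ∃ π : Literature.NumberTheory.Automorphic.CuspidalAutomorphicRepData 2 F hcpt, π.1.IsLAlgebraic ∧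
        ∀ᶠ w : IsDedekindDomain.HeightOneSpectrum (NumberField.RingOfIntegers F) in Filter.cofinite, ∃ α : Multiset ℂ,
          π.1.HasSatakeParamAt w α ∧ (α.map fun a => a⁻¹).sum = (Literature.NumberTheory.Automorphic.frobTraceAt E w : ℂ) ∧
            (α.map fun a => a⁻¹).prod = (w.residueCard : ℂ)) :
    NonOrdinaryEisensteinModular := by
  intro F _ _ _ _ p _ _ E hΔ hcm _ _ hcpt
  exact h F E hΔ hcm hcpt

/-- The RESTATED item of the route is the frame `SectorComplement` (stmt-Langlands-16058), implied by the summit by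
discarding its hypothesis. [folklore] -/
theorem sectorComplement_of_langlands : _root_.Langlands → SectorComplement := fun h _ => h

/-- `SectorComplement` is literally `Target → Langlands`. [folklore] -/
theorem sectorComplement_iff : SectorComplement ↔ (Target → _root_.Langlands) := Iff.rfl

/-- The five case cruxes produce `Target` (the support item `TargetOfCruxes`, provable now; body of `closes` minus
its last step). [folklore] -/
theorem targetOfCruxes_holds' : TargetOfCruxes := by
  intro h1 h3 h2 hE h4 F _ _ htc hdeg E hΔ hcm hcpt
  haveI h5 : Fact (Nat.Prime 5) := ⟨by norm_num⟩
  by_cases hirr : (E.baseChange F).HasIrreducibleModPGaloisRep 5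
  · exact h1 F htc hdeg E hΔ hcm hirr hcpt
  · by_cases hA : (∃ ρ : Literature.NumberTheory.GaloisRepresentations.FramedGaloisRep F (PadicAlgCl 5) 2, (ρ.toGaloisRep.IsIrreducible ∧ ∀ᶠ w : IsDedekindDomain.HeightOneSpectrum (NumberField.RingOfIntegers F) in Filter.cofinite, ρ.IsUnramifiedAt w ∧ ρ.HasFrobCharpolyAt w (Polynomial.X ^ 2 - Polynomial.C ((Literature.NumberTheory.Automorphic.frobTraceAt E w : ℤ) : PadicAlgCl 5) * Polynomial.X + Polynomial.C ((w.residueCard : ℕ) : PadicAlgCl 5))) ∧ ∀ v : IsDedekindDomain.HeightOneSpectrum (NumberField.RingOfIntegers F), ((5 : ℕ) : NumberField.RingOfIntegers F) ∈ v.asIdeal → ∃ m : ℕ, 0 < m ∧ ρ.IsOrdinaryOfWeightAt 5 v 2 m)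
    · by_cases hB : (∃ (O : ValuationSubring (PadicAlgCl 5)) (ρ : Literature.NumberTheory.GaloisRepresentations.FramedGaloisRep F (PadicAlgCl 5) 2) (ρ₀ : Field.absoluteGaloisGroup F →* Matrix.GeneralLinearGroup (Fin 2) O), O = (Valued.v : Valuation (PadicAlgCl 5) NNReal).valuationSubring ∧ (ρ.toGaloisRep.IsIrreducible ∧ ∀ᶠ w : IsDedekindDomain.HeightOneSpectrum (NumberField.RingOfIntegers F) in Filter.cofinite, ρ.IsUnramifiedAt w ∧ ρ.HasFrobCharpolyAt w (Polynomial.X ^ 2 - Polynomial.C ((Literature.NumberTheory.Automorphic.frobTraceAt E w : ℤ) : PadicAlgCl 5) * Polynomial.X + Polynomial.C ((w.residueCard : ℕ) : PadicAlgCl 5))) ∧ ρ.HasUpperTriangularIntegralModel ρ₀ ∧ ∃ m : ℕ, 0 < m ∧ ∀ v : IsDedekindDomain.HeightOneSpectrum (NumberField.RingOfIntegers F), ((5 : ℕ) : NumberField.RingOfIntegers F) ∈ v.asIdeal → Literature.NumberTheory.GaloisRepresentations.IsPDistinguishedAt ρ₀ v ∧ ∃ Q : Matrix.GeneralLinearGroup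 (Fin 2) (PadicAlgCl 5), Valued.v (Q.val 0 0) ≤ Valued.v (Q.val 1 0) ∧ ∀ σ, (Q⁻¹ * ρ.toLocal v σ * Q).val 1 0 = 0 ∧ (σ ∈ Literature.NumberTheory.GaloisRepresentations.absInertia (v.adicCompletion F) → (Q⁻¹ * ρ.toLocal v σ * Q).val 1 1 ^ m = 1 ∧ (Q⁻¹ * ρ.toLocal v σ * Q).val 0 0 ^ m = algebraMap (Padic 5) (PadicAlgCl 5) (((Literature.NumberTheory.GaloisRepresentations.GaloisRep.cyclotomicCharacter (v.adicCompletion F) 5 σ).val : PadicInt 5) : Padic 5) ^ ((2 - 1) * m)))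
      · exact h4 hE F htc hdeg 5 (by norm_num) E hΔ hcm hB hcpt
      · exact h2 F htc hdeg 5 (by norm_num) E hΔ hcm hirr hA hB hcpt
    · exact h3 F htc hdeg 5 (by norm_num) E hΔ hcm hirr hA hcpt

/-- Hence, modulo the OTHER four case cruxes, `C` is exactly what separates them from `Target`; and `closes` =
`SectorComplement` applied to that `Target`. [folklore] -/
theorem closes_reading (h1 : IrreducibleFiveModular) (h2 : UnorientedOrdinaryModular) (hE : ReducibleOrdinaryModular)
    (h4 : OrientedOrdinaryOfEngine) : (NonOrdinaryEisensteinModular → Target) ∧ (Target → NonOrdinaryEisensteinModular) :=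
  ⟨fun h3 => targetOfCruxes_holds' h1 h3 h2 hE h4, target_imp_nonOrdinaryEisensteinModular⟩

end Summit.Langlands.Langlands.Cruxes.NonOrdinaryEisensteinModular.RedirectR1
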